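import Literature.Topology.FourManifolds.CylinderBoundaryExtension
import Literature.Topology.FourManifolds.LocalDiffeomorphOrientation
import Literature.Topology.FourManifolds.BoundaryOrientation
import Literature.Topology.FourManifolds.CerfTheoremOneProofs
import HarnessLib

/-!
# An orientation-preserving, end-preserving diffeomorphism of the boundary of a cylinder with circle ends extends over the cylinder

Topic `Literature/Topology/FourManifolds`; written for the fact seat
`provefact-Literature.Topology.FourManifolds.nonempty_diffeomorph_sphere_four_of_sblf_genus_one_noLefschetz`
(torus assembly step of the classification of closed oriented surfaces of genus one).  Everything
here is **proved**; no named facts.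

## Mathematics

Let `W` be a smooth manifold with boundary (model `𝓡∂ (n + 1)`) together with a diffeomorphism
`T : W ≅ N × [0, 1]` onto a cylinder over a manifold `N` without boundary (model `𝓡 n`).  Then
`∂W = T⁻¹ (N × {0}) ⊔ T⁻¹ (N × {1})` (Mathlib `Diffeomorph.preimage_boundary`,
`boundary_product`; `mem_boundary_iff_snd`), the two **ends** of `W`, each parametrised by `N`
through the smooth sections `endSection T e : N → ∂W`, `x ↦ T⁻¹ (x, e)` (`e = 0, 1`), with
common smooth retraction `endProj T : ∂W → N`, `w ↦ (T w).1` — a local diffeomorphism of the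
boundary manifold `∂W` (restricted boundary charts, `Cobordism.lean`) onto `N`.

A self-diffeomorphism `ψ` of `∂W` **preserving the ends** (`(T (ψ w)).2 = (T w).2`) induces the
two **end maps** `ψₑ = endProj ∘ ψ ∘ endSection e ∈ Diff N` (`endMap`), and `ψ` extends to a
self-diffeomorphism of `W` as soon as both end maps are diffeotopic to the identity
(`exists_diffeomorph_extends_of_isDiffeotopicToId`: the double slide of
`CylinderBoundaryExtension.lean`, transferred along `T`).

**Orientations.** If `W` is oriented by `oW`, `∂W` carries the boundary orientation `oW.boundary`
(`BoundaryOrientation.lean`), and for any orientation `u` of a *connected* `N`: **if `ψ` preserves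
`oW.boundary`, every end map `ψₑ` preserves `u`** (`isOrientationPreserving_endMap`).  Indeed
`ψₑ ∘ endProj = endProj ∘ ψ` near the end `e`, the orientation character of the local
diffeomorphism `endProj` (for `oW.boundary`, `u`) is constant along the connected end
(`LocalDiffeomorphOrientation.lean`), and characters multiply under composition; so the
character of `ψₑ` at `endProj w` is that of `ψ` at `w`.

**Circle ends** (`n = 1`, `N = 𝕊¹`).  By Cerf's Proposition 4 at `n = 1` (every diffeomorphism
of `𝕊¹` is diffeotopic to the identity or to a reflection,
`Diffeomorph.isDiffeotopicToId_or_isDiffeotopic_sphereReflection_circle`, `CerfPropositionFour.lean`)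
an orientation-preserving diffeomorphism of `𝕊¹` is diffeotopic to the identity
(`Diffeomorph.isDiffeotopicToId_of_isOrientationPreserving_circle`, `CerfTheoremOneProofs.lean`).
Hence the **extension theorem** `exists_diffeomorph_extends_of_isOrientationPreserving`: *an
end-preserving self-diffeomorphism of `∂W` which preserves the boundary orientation of an
oriented `W ≅ 𝕊¹ × [0, 1]` extends to a self-diffeomorphism of `W`.*  This is the classical
"a diffeomorphism of `∂(S¹ × I)` preserving each boundary circle with its orientation extends
over the annulus" (e.g. the `n = 1` case of: `h ∈ Diff(Sⁿ)` extends over `Sⁿ × I` relative to the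
other end iff `h` is pseudo-isotopic to the identity; Cerf (1968), Ch. I §1; Hirsch (1976), Ch. 8
§2, proof of Thm. 2.3, and §3, Thm. 3.3 for surfaces).

## References

* J. Cerf, *Sur les difféomorphismes de la sphère de dimension trois (Γ₄ = 0)*, LNM 53 (1968),
  Appendice, Prop. 4 (`n = 1`). [CerfDiffeoSphere1968]
* M. W. Hirsch, *Differential Topology*, GTM 33 (1976), Ch. 4 §4 (orientation characters),
  Ch. 8 §2 proof of Thm. 2.3 (spreading an isotopy over a collar), Ch. 9 §3 (surfaces).
  [HirschDT1976]
* J. Milnor, *Lectures on the h-cobordism theorem* (1965), §1, Thm. 1.4 and Lemma 8.2.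
  [MilnorHCobordism1965]
-/

open scoped Manifold ContDiff Topology
open Function Set Filter Module

noncomputable section

namespace Literature.Topology.FourManifolds

universe u

/-- Local notation: `𝔼 n` is the model Euclidean space `EuclideanSpace ℝ (Fin n)`. -/
local notation "𝔼 " n:arg => EuclideanSpace ℝ (Fin n)
/-- Local notation: `𝕊 n` is the unit sphere in `EuclideanSpace ℝ (Fin (n + 1))`. -/
local notation "𝕊 " n:arg => (Metric.sphere (0 : EuclideanSpace ℝ (Fin (n + 1))) 1)

/-! ### §1 The ends of an abstract cylinder `W ≅ N × [0, 1]` -/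

section Ends

variable {n : ℕ} {W : Type u} [TopologicalSpace W] [ChartedSpace (EuclideanHalfSpace (n + 1)) W]
  [IsManifold (𝓡∂ (n + 1)) ∞ W]
  {N : Type*} [TopologicalSpace N] [ChartedSpace (𝔼 n) N]

omit [IsManifold (𝓡∂ (n + 1)) ∞ W] in
/-- **The boundary of an abstract cylinder**: for `T : W ≅ N × [0, 1]` (`N` without boundary),
`w ∈ ∂W` iff `T w` lies over an end point of `[0, 1]` (Mathlib: diffeomorphisms preserve the
boundary, `∂(N × [0, 1]) = N × {0, 1}`). [folklore] -/
theorem mem_boundary_iff_snd (T : W ≃ₘ⟮𝓡∂ (n + 1), (𝓡 n).prod (𝓡∂ 1)⟯ (N × Set.Icc (0 : ℝ) 1)) (w : W) :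
    w ∈ (𝓡∂ (n + 1)).boundary W ↔ (T w).2 = ⊥ ∨ (T w).2 = ⊤ := by
  rw [← T.preimage_boundary (by simp), mem_preimage, boundary_product]
  change (T w).1 ∈ univ ∧ (T w).2 ∈ ({⊥, ⊤} : Set (Set.Icc (0 : ℝ) 1)) ↔ _
  simp only [mem_univ, true_and, mem_insert_iff, mem_singleton_iff]

omit [IsManifold (𝓡∂ (n + 1)) ∞ W] in
/-- A boundary point of the cylinder lies over `0` or over `1`. [folklore] -/
theorem snd_eq_bot_or_eq_top (T : W ≃ₘ⟮𝓡∂ (n + 1), (𝓡 n).prod (𝓡∂ 1)⟯ (N × Set.Icc (0 : ℝ) 1))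
    (w : (𝓡∂ (n + 1)).boundary W) : (T w.1).2 = ⊥ ∨ (T w.1).2 = ⊤ :=
  (mem_boundary_iff_snd T w.1).1 w.2

/-- **The end sections** `x ↦ T⁻¹ (x, e)` of the cylinder (`e` an end point of `[0, 1]`), valued
in the boundary manifold `∂W`. [folklore] -/
def endSection (T : W ≃ₘ⟮𝓡∂ (n + 1), (𝓡 n).prod (𝓡∂ 1)⟯ (N × Set.Icc (0 : ℝ) 1))
    (e : Set.Icc (0 : ℝ) 1) (he : e = ⊥ ∨ e = ⊤) (x : N) : (𝓡∂ (n + 1)).boundary W :=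
  ⟨T.symm (x, e), (mem_boundary_iff_snd T _).2 (by rwa [Diffeomorph.apply_symm_apply])⟩

omit [IsManifold (𝓡∂ (n + 1)) ∞ W] in
/-- The underlying point of `endSection T e x` is `T⁻¹ (x, e)` (definitional). [folklore] -/
@[simp]
theorem coe_endSection (T : W ≃ₘ⟮𝓡∂ (n + 1), (𝓡 n).prod (𝓡∂ 1)⟯ (N × Set.Icc (0 : ℝ) 1))
    {e : Set.Icc (0 : ℝ) 1} (he : e = ⊥ ∨ e = ⊤) (x : N) : (endSection T e he x).1 = T.symm (x, e) := rfl

omit [IsManifold (𝓡∂ (n + 1)) ∞ W] in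
/-- `T (endSection T e x) = (x, e)`. [folklore] -/
@[simp]
theorem apply_coe_endSection (T : W ≃ₘ⟮𝓡∂ (n + 1), (𝓡 n).prod (𝓡∂ 1)⟯ (N × Set.Icc (0 : ℝ) 1))
    {e : Set.Icc (0 : ℝ) 1} (he : e = ⊥ ∨ e = ⊤) (x : N) : T (endSection T e he x).1 = (x, e) := by
  rw [coe_endSection, Diffeomorph.apply_symm_apply]

/-- **The end retraction** `w ↦ (T w).1 : ∂W → N`. [folklore] -/
def endProj (T : W ≃ₘ⟮𝓡∂ (n + 1), (𝓡 n).prod (𝓡∂ 1)⟯ (N × Set.Icc (0 : ℝ) 1))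
    (w : (𝓡∂ (n + 1)).boundary W) : N := (T w.1).1

omit [IsManifold (𝓡∂ (n + 1)) ∞ W] in
/-- `endProj T (endSection T e x) = x`. [folklore] -/
@[simp]
theorem endProj_endSection (T : W ≃ₘ⟮𝓡∂ (n + 1), (𝓡 n).prod (𝓡∂ 1)⟯ (N × Set.Icc (0 : ℝ) 1))
    {e : Set.Icc (0 : ℝ) 1} (he : e = ⊥ ∨ e = ⊤) (x : N) : endProj T (endSection T e he x) = x := by
  rw [endProj, apply_coe_endSection]

omit [IsManifold (𝓡∂ (n + 1)) ∞ W] in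
/-- On the end over `e`, `endSection T e ∘ endProj T` is the identity. [folklore] -/
theorem endSection_endProj (T : W ≃ₘ⟮𝓡∂ (n + 1), (𝓡 n).prod (𝓡∂ 1)⟯ (N × Set.Icc (0 : ℝ) 1))
    {e : Set.Icc (0 : ℝ) 1} (he : e = ⊥ ∨ e = ⊤) {w : (𝓡∂ (n + 1)).boundary W} (hw : (T w.1).2 = e) :
    endSection T e he (endProj T w) = w := by
  apply Subtype.ext
  rw [coe_endSection, endProj]
  have h : ((T w.1).1, e) = T w.1 := Prod.ext rfl hw.symm
  rw [h, Diffeomorph.symm_apply_apply]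

/-- The end section is smooth (as a map into the boundary manifold `∂W`: its composite with the
immersion `∂W ↪ W` is the smooth map `x ↦ T⁻¹ (x, e)`). [folklore] -/
theorem contMDiff_endSection (T : W ≃ₘ⟮𝓡∂ (n + 1), (𝓡 n).prod (𝓡∂ 1)⟯ (N × Set.Icc (0 : ℝ) 1))
    {e : Set.Icc (0 : ℝ) 1} (he : e = ⊥ ∨ e = ⊤) : ContMDiff (𝓡 n) (𝓡 n) ∞ (endSection T e he) := by
  rw [ContMDiff.iff_comp_isImmersion BoundaryManifold.isImmersion_subtype_val]
  refine ⟨?_, ?_⟩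
  · exact Continuous.subtype_mk (T.symm.continuous.comp (continuous_id.prodMk continuous_const)) _
  · exact T.symm.contMDiff.comp (contMDiff_id.prodMk contMDiff_const)

/-- The end section is continuous. [folklore] -/
theorem continuous_endSection (T : W ≃ₘ⟮𝓡∂ (n + 1), (𝓡 n).prod (𝓡∂ 1)⟯ (N × Set.Icc (0 : ℝ) 1))
    {e : Set.Icc (0 : ℝ) 1} (he : e = ⊥ ∨ e = ⊤) : Continuous (endSection T e he) :=
  (contMDiff_endSection T he).continuous

/-- The end retraction is smooth. [folklore] -/
theorem contMDiff_endProj (T : W ≃ₘ⟮𝓡∂ (n + 1), (𝓡 n).prod (𝓡∂ 1)⟯ (N × Set.Icc (0 : ℝ) 1)) :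
    ContMDiff (𝓡 n) (𝓡 n) ∞ (endProj T) :=
  contMDiff_fst.comp (T.contMDiff.comp BoundaryManifold.isSmoothEmbedding_subtype_val.contMDiff)

/-- The end retraction is continuous. [folklore] -/
theorem continuous_endProj (T : W ≃ₘ⟮𝓡∂ (n + 1), (𝓡 n).prod (𝓡∂ 1)⟯ (N × Set.Icc (0 : ℝ) 1)) :
    Continuous (endProj T) := (contMDiff_endProj T).continuous

/-- **The end retraction is a local diffeomorphism**: its Jacobian determinant (in the preferred
charts of `∂W` and `N`, both modelled on `ℝⁿ`) vanishes nowhere, since it has the smooth local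
sections `endSection T e`. [folklore] -/
theorem det_mfderiv_endProj_ne_zero (T : W ≃ₘ⟮𝓡∂ (n + 1), (𝓡 n).prod (𝓡∂ 1)⟯ (N × Set.Icc (0 : ℝ) 1))
    (w : (𝓡∂ (n + 1)).boundary W) :
    LinearMap.det (M := 𝔼 n) (mfderiv (𝓡 n) (𝓡 n) (endProj T) w).toLinearMap ≠ 0 := by
  -- `w` lies on the end over `e := (T w).2`
  have he' : (T w.1).2 = ⊥ ∨ (T w.1).2 = ⊤ := snd_eq_bot_or_eq_top T w
  set x : N := endProj T w with hx
  have hw : endSection T (T w.1).2 he' x = w := endSection_endProj T he' rfl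
  have hsec : endProj T ∘ endSection T (T w.1).2 he' = id :=
    funext fun y => endProj_endSection T he' y
  have hS : MDifferentiableAt (𝓡 n) (𝓡 n) (endSection T (T w.1).2 he') x :=
    (contMDiff_endSection T he').mdifferentiableAt (by simp)
  have hP : MDifferentiableAt (𝓡 n) (𝓡 n) (endProj T) (endSection T (T w.1).2 he' x) :=
    (contMDiff_endProj T).mdifferentiableAt (by simp)
  have hchain := mfderiv_comp x hP hS
  rw [hsec, mfderiv_id, hw] at hchain
  suffices h : ∀ A B : (𝔼 n) →L[ℝ] (𝔼 n), A.comp B = ContinuousLinearMap.id ℝ (𝔼 n) →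
      LinearMap.det (A : (𝔼 n) →ₗ[ℝ] (𝔼 n)) ≠ 0 from h _ _ hchain.symm
  intro A B h
  exact left_ne_zero_of_mul_eq_one (det_mul_det_eq_one_of_comp_eq_id h)

omit [IsManifold (𝓡∂ (n + 1)) ∞ W] in
/-- The end over `e` is open in `∂W`. [folklore] -/
theorem isOpen_setOf_snd_eq (T : W ≃ₘ⟮𝓡∂ (n + 1), (𝓡 n).prod (𝓡∂ 1)⟯ (N × Set.Icc (0 : ℝ) 1))
    {e : Set.Icc (0 : ℝ) 1} (he : e = ⊥ ∨ e = ⊤) :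
    IsOpen {w : (𝓡∂ (n + 1)).boundary W | (T w.1).2 = e} := by
  have hc : Continuous fun w : (𝓡∂ (n + 1)).boundary W => ((T w.1).2 : ℝ) :=
    continuous_subtype_val.comp (continuous_snd.comp (T.continuous.comp continuous_subtype_val))
  rcases he with rfl | rfl
  · have hset : {w : (𝓡∂ (n + 1)).boundary W | (T w.1).2 = ⊥} =
        (fun w : (𝓡∂ (n + 1)).boundary W => ((T w.1).2 : ℝ)) ⁻¹' Iio (1 / 2) := by
      ext w
      simp only [mem_setOf_eq, mem_preimage, mem_Iio]
      rcases snd_eq_bot_or_eq_top T w with h | h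
      · rw [h]
        exact iff_of_true rfl (by rw [Set.Icc.coe_bot]; norm_num)
      · rw [h]
        refine iff_of_false (fun h' => ?_) (by rw [Set.Icc.coe_top]; norm_num)
        have := congrArg (fun t : Set.Icc (0 : ℝ) 1 => (t : ℝ)) h'
        simp only [Set.Icc.coe_top, Set.Icc.coe_bot] at this
        exact one_ne_zero this
    rw [hset]
    exact isOpen_Iio.preimage hc
  · have hset : {w : (𝓡∂ (n + 1)).boundary W | (T w.1).2 = ⊤} =
        (fun w : (𝓡∂ (n + 1)).boundary W => ((T w.1).2 : ℝ)) ⁻¹' Ioi (1 / 2) := by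
      ext w
      simp only [mem_setOf_eq, mem_preimage, mem_Ioi]
      rcases snd_eq_bot_or_eq_top T w with h | h
      · rw [h]
        refine iff_of_false (fun h' => ?_) (by rw [Set.Icc.coe_bot]; norm_num)
        have := congrArg (fun t : Set.Icc (0 : ℝ) 1 => (t : ℝ)) h'
        simp only [Set.Icc.coe_top, Set.Icc.coe_bot] at this
        exact zero_ne_one this
      · rw [h]
        exact iff_of_true rfl (by rw [Set.Icc.coe_top]; norm_num)
    rw [hset]
    exact isOpen_Ioi.preimage hc

/-- The end over `e` is the range of the end section, hence preconnected when `N` is connected.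
[folklore] -/
theorem isPreconnected_setOf_snd_eq [PreconnectedSpace N] (T : W ≃ₘ⟮𝓡∂ (n + 1), (𝓡 n).prod (𝓡∂ 1)⟯ (N × Set.Icc (0 : ℝ) 1))
    {e : Set.Icc (0 : ℝ) 1} (he : e = ⊥ ∨ e = ⊤) :
    IsPreconnected {w : (𝓡∂ (n + 1)).boundary W | (T w.1).2 = e} := by
  have hrange : range (endSection T e he) = {w : (𝓡∂ (n + 1)).boundary W | (T w.1).2 = e} := by
    ext w
    constructor
    · rintro ⟨x, rfl⟩
      show (T (endSection T e he x).1).2 = e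
      rw [apply_coe_endSection]
    · intro hw
      exact ⟨endProj T w, endSection_endProj T he hw⟩
  rw [← hrange]
  exact isPreconnected_range (continuous_endSection T he)

/-! ### §2 The end maps of an end-preserving diffeomorphism of `∂W` -/

/-- An end-preserving diffeomorphism has end-preserving inverse. [folklore] -/
theorem snd_apply_symm (T : W ≃ₘ⟮𝓡∂ (n + 1), (𝓡 n).prod (𝓡∂ 1)⟯ (N × Set.Icc (0 : ℝ) 1))
    (ψ : (𝓡∂ (n + 1)).boundary W ≃ₘ⟮𝓡 n, 𝓡 n⟯ (𝓡∂ (n + 1)).boundary W)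
    (hE : ∀ w, (T (ψ w).1).2 = (T w.1).2)
    (w : (𝓡∂ (n + 1)).boundary W) : (T (ψ.symm w).1).2 = (T w.1).2 := by
  conv_rhs => rw [← ψ.apply_symm_apply w]
  exact (hE (ψ.symm w)).symm

/-- **The end map** `ψₑ = endProj ∘ ψ ∘ endSection e ∈ Diff N` of an end-preserving
self-diffeomorphism `ψ` of `∂W` at the end `e`. [folklore] -/
def endMap (T : W ≃ₘ⟮𝓡∂ (n + 1), (𝓡 n).prod (𝓡∂ 1)⟯ (N × Set.Icc (0 : ℝ) 1))
    {e : Set.Icc (0 : ℝ) 1} (he : e = ⊥ ∨ e = ⊤)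
    (ψ : (𝓡∂ (n + 1)).boundary W ≃ₘ⟮𝓡 n, 𝓡 n⟯ (𝓡∂ (n + 1)).boundary W)
    (hE : ∀ w, (T (ψ w).1).2 = (T w.1).2) : N ≃ₘ⟮𝓡 n, 𝓡 n⟯ N where
  toFun x := endProj T (ψ (endSection T e he x))
  invFun x := endProj T (ψ.symm (endSection T e he x))
  left_inv x := by
    have h1 : (T (ψ (endSection T e he x)).1).2 = e := by rw [hE, apply_coe_endSection]
    simp only
    rw [endSection_endProj T he h1, Diffeomorph.symm_apply_apply, endProj_endSection]
  right_inv x := by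
    have h1 : (T (ψ.symm (endSection T e he x)).1).2 = e := by
      rw [snd_apply_symm T ψ hE, apply_coe_endSection]
    simp only
    rw [endSection_endProj T he h1, Diffeomorph.apply_symm_apply, endProj_endSection]
  contMDiff_toFun :=
    (contMDiff_endProj T).comp (ψ.contMDiff.comp (contMDiff_endSection T he))
  contMDiff_invFun :=
    (contMDiff_endProj T).comp (ψ.symm.contMDiff.comp (contMDiff_endSection T he))

/-- The end map as a function (definitional). [folklore] -/
theorem endMap_apply (T : W ≃ₘ⟮𝓡∂ (n + 1), (𝓡 n).prod (𝓡∂ 1)⟯ (N × Set.Icc (0 : ℝ) 1))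
    {e : Set.Icc (0 : ℝ) 1} (he : e = ⊥ ∨ e = ⊤)
    (ψ : (𝓡∂ (n + 1)).boundary W ≃ₘ⟮𝓡 n, 𝓡 n⟯ (𝓡∂ (n + 1)).boundary W)
    (hE : ∀ w, (T (ψ w).1).2 = (T w.1).2) (x : N) :
    endMap T he ψ hE x = endProj T (ψ (endSection T e he x)) := rfl

/-- **`ψₑ ∘ endProj = endProj ∘ ψ` on the end over `e`.** [folklore] -/
theorem endMap_endProj (T : W ≃ₘ⟮𝓡∂ (n + 1), (𝓡 n).prod (𝓡∂ 1)⟯ (N × Set.Icc (0 : ℝ) 1))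
    {e : Set.Icc (0 : ℝ) 1} (he : e = ⊥ ∨ e = ⊤)
    (ψ : (𝓡∂ (n + 1)).boundary W ≃ₘ⟮𝓡 n, 𝓡 n⟯ (𝓡∂ (n + 1)).boundary W)
    (hE : ∀ w, (T (ψ w).1).2 = (T w.1).2) {w : (𝓡∂ (n + 1)).boundary W} (hw : (T w.1).2 = e) :
    endMap T he ψ hE (endProj T w) = endProj T (ψ w) := by
  rw [endMap_apply, endSection_endProj T he hw]

/-- In the cylinder coordinates, `ψ` acts on the end over `e` as `ψₑ × {e}`. [folklore] -/
theorem apply_coe_eq_of_snd_eq (T : W ≃ₘ⟮𝓡∂ (n + 1), (𝓡 n).prod (𝓡∂ 1)⟯ (N × Set.Icc (0 : ℝ) 1))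
    {e : Set.Icc (0 : ℝ) 1} (he : e = ⊥ ∨ e = ⊤)
    (ψ : (𝓡∂ (n + 1)).boundary W ≃ₘ⟮𝓡 n, 𝓡 n⟯ (𝓡∂ (n + 1)).boundary W)
    (hE : ∀ w, (T (ψ w).1).2 = (T w.1).2) {w : (𝓡∂ (n + 1)).boundary W} (hw : (T w.1).2 = e) :
    T (ψ w).1 = (endMap T he ψ hE (T w.1).1, e) := by
  refine Prod.ext ?_ ?_
  · exact (endMap_endProj T he ψ hE hw).symm
  · rw [hE, hw]

/-- **Extension over the cylinder when the end maps are diffeotopic to the identity.** If both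
end maps `ψ₀`, `ψ₁` of the end-preserving diffeomorphism `ψ` of `∂W` are diffeotopic to the
identity of `N`, then `ψ` extends to a self-diffeomorphism `Φ` of `W`: `Φ w = ψ w` on `∂W`
(the double slide of `CylinderBoundaryExtension.lean`, transferred along `T`; Hirsch (1976),
Ch. 8 §2, proof of Thm. 2.3). [cite: HirschDT1976, Ch. 8 §2, proof of Thm. 2.3] -/
theorem exists_diffeomorph_extends_of_isDiffeotopicToId (T : W ≃ₘ⟮𝓡∂ (n + 1), (𝓡 n).prod (𝓡∂ 1)⟯ (N × Set.Icc (0 : ℝ) 1))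
    (ψ : (𝓡∂ (n + 1)).boundary W ≃ₘ⟮𝓡 n, 𝓡 n⟯ (𝓡∂ (n + 1)).boundary W)
    (hE : ∀ w, (T (ψ w).1).2 = (T w.1).2)
    (h0 : Diffeomorph.IsDiffeotopicToId (endMap T (e := ⊥) (Or.inl rfl) ψ hE))
    (h1 : Diffeomorph.IsDiffeotopicToId (endMap T (e := ⊤) (Or.inr rfl) ψ hE)) :
    ∃ Φ : W ≃ₘ⟮𝓡∂ (n + 1), 𝓡∂ (n + 1)⟯ W, ∀ w : (𝓡∂ (n + 1)).boundary W, Φ w.1 = (ψ w).1 := by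
  obtain ⟨D₀, hD₀⟩ := h0
  obtain ⟨D₁, hD₁⟩ := h1
  refine exists_diffeomorph_apply_eq_of_diffeotopies T D₀ D₁
    (fun w : (𝓡∂ (n + 1)).boundary W => w.1) (fun w => (ψ w).1) fun w => ?_
  rcases snd_eq_bot_or_eq_top T w with hw | hw
  · left
    refine ⟨hw, ?_⟩
    rw [apply_coe_eq_of_snd_eq T (Or.inl rfl) ψ hE hw, ← Diffeotopy.coe_stage, hD₀]
  · right
    refine ⟨hw, ?_⟩
    rw [apply_coe_eq_of_snd_eq T (Or.inr rfl) ψ hE hw, ← Diffeotopy.coe_stage, hD₁]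

/-! ### §3 Orientation characters of the end maps -/

/-- Propositional bookkeeping for `isOrientationPreserving_endMap`. [folklore] -/
theorem endMap_character_bookkeeping {A A' Cg Cp Cp' Ct : Prop} (h1 : A ↔ (Cg ↔ Cp))
    (h2 : A' ↔ (Cp' ↔ Ct)) (hA : A ↔ A') (h3 : Cp ↔ Cp') (h4 : Ct) : Cg := by
  tauto

/-- **The end maps of an orientation-preserving diffeomorphism are orientation preserving.**
Let `W` be oriented by `oW`, `∂W` by the boundary orientation `oW.boundary`, and the connected `N`
by any orientation `u`.  If the end-preserving diffeomorphism `ψ` of `∂W` preserves `oW.boundary`,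
then each end map `ψₑ ∈ Diff N` preserves `u`.  Proof: `ψₑ ∘ endProj = endProj ∘ ψ` near the end
over `e`; at a point `w` of that end the pointwise chain rule for orientation characters
(`isOrientationPreservingAt_comp_iff`) gives `χ(ψₑ)(endProj w) · χ(endProj)(w) =
χ(endProj)(ψ w) · χ(ψ)(w)`, and `χ(endProj)` is constant along the connected end
(`isOrientationPreservingAt_iff_of_isPreconnected`). Hirsch, *Differential Topology* (1976),
Ch. 4 §4. [cite: HirschDT1976, §4.4 p. 101] -/
theorem isOrientationPreserving_endMap [IsManifold (𝓡 n) ∞ N] [PreconnectedSpace N] (T : W ≃ₘ⟮𝓡∂ (n + 1), (𝓡 n).prod (𝓡∂ 1)⟯ (N × Set.Icc (0 : ℝ) 1))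
    {e : Set.Icc (0 : ℝ) 1} (he : e = ⊥ ∨ e = ⊤)
    (ψ : (𝓡∂ (n + 1)).boundary W ≃ₘ⟮𝓡 n, 𝓡 n⟯ (𝓡∂ (n + 1)).boundary W)
    (hE : ∀ w, (T (ψ w).1).2 = (T w.1).2) (oW : SmoothOrientation (𝓡∂ (n + 1)) W)
    (u : SmoothOrientation (𝓡 n) N) (hP : IsOrientationPreserving oW.boundary oW.boundary ψ) :
    (endMap T he ψ hE).IsOrientationPreserving u u := by
  intro x
  set g := endMap T he ψ hE with hg_def
  set p : (𝓡∂ (n + 1)).boundary W → N := endProj T with hp_def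
  set w : (𝓡∂ (n + 1)).boundary W := endSection T e he x with hw_def
  have hw : (T w.1).2 = e := by rw [hw_def, apply_coe_endSection]
  have hψw : (T (ψ w).1).2 = e := by rw [hE, hw]
  have hpw : p w = x := endProj_endSection T he x
  -- differentiability and Jacobians
  have hpd : ∀ z, MDifferentiableAt (𝓡 n) (𝓡 n) p z := fun z =>
    (contMDiff_endProj T).mdifferentiableAt (by simp)
  have hgd : ∀ y, MDifferentiableAt (𝓡 n) (𝓡 n) g y := fun y => g.mdifferentiable (by simp) y
  have hψd : ∀ z, MDifferentiableAt (𝓡 n) (𝓡 n) ψ z := fun z => ψ.mdifferentiable (by simp) z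
  have hpdet : ∀ z, LinearMap.det (M := 𝔼 n) (mfderiv (𝓡 n) (𝓡 n) p z).toLinearMap ≠ 0 :=
    det_mfderiv_endProj_ne_zero T
  have hgdet : ∀ y, LinearMap.det (M := 𝔼 n) (mfderiv (𝓡 n) (𝓡 n) g y).toLinearMap ≠ 0 :=
    fun y => g.det_mfderiv_ne_zero (by simp) y
  have hψdet : ∀ z, LinearMap.det (M := 𝔼 n) (mfderiv (𝓡 n) (𝓡 n) ψ z).toLinearMap ≠ 0 :=
    fun z => ψ.det_mfderiv_ne_zero (by simp) z
  -- `g ∘ p = p ∘ ψ` near `w`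
  have hev : (⇑g ∘ p) =ᶠ[𝓝 w] (p ∘ ⇑ψ) := by
    filter_upwards [(isOpen_setOf_snd_eq T he).mem_nhds hw] with z hz
    exact endMap_endProj T he ψ hE hz
  have hmf : mfderiv (𝓡 n) (𝓡 n) (⇑g ∘ p) w = mfderiv (𝓡 n) (𝓡 n) (p ∘ ⇑ψ) w := hev.mfderiv_eq
  have hval : g (p w) = p (ψ w) := endMap_endProj T he ψ hE hw
  -- pointwise chain rules for characters
  have h1 := isOrientationPreservingAt_comp_iff oW.boundary u u (g := ⇑g) (f := p) (x := w)
    (hgd _) (hpd _) (hgdet _) (hpdet _)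
  have h2 := isOrientationPreservingAt_comp_iff oW.boundary oW.boundary u (g := p) (f := ⇑ψ)
    (x := w) (hpd _) (hψd _) (hpdet _) (hψdet _)
  rw [hmf] at h1
  simp only [comp_apply] at h1 h2
  have hA : (u (g (p w)) = oW.boundary w ↔
      0 < LinearMap.det (M := 𝔼 n) (mfderiv (𝓡 n) (𝓡 n) (p ∘ ⇑ψ) w).toLinearMap) ↔
      (u (p (ψ w)) = oW.boundary w ↔
      0 < LinearMap.det (M := 𝔼 n) (mfderiv (𝓡 n) (𝓡 n) (p ∘ ⇑ψ) w).toLinearMap) := by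
    rw [hval]
  -- constancy of the character of `p` along the end
  have h3 := isOrientationPreservingAt_iff_of_isPreconnected (contMDiff_endProj T) (by simp)
    (det_mfderiv_endProj_ne_zero T) oW.boundary u (isPreconnected_setOf_snd_eq T he) hw hψw
  have h4 : oW.boundary (ψ w) = oW.boundary w ↔
      0 < LinearMap.det (M := 𝔼 n) (mfderiv (𝓡 n) (𝓡 n) ψ w).toLinearMap := hP w
  rw [← hpw]
  exact endMap_character_bookkeeping h1 h2 hA h3 h4

end Ends

/-! ### §4 Circle ends: the extension theorem -/

section Circle

variable {W : Type u} [TopologicalSpace W] [ChartedSpace (EuclideanHalfSpace (1 + 1)) W]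
  [IsManifold (𝓡∂ (1 + 1)) ∞ W]

/-- **Extension theorem for cylinders with circle ends.** Let `W` be an oriented smooth surface
with boundary diffeomorphic to the annulus, `T : W ≅ 𝕊¹ × [0, 1]`, and let `ψ` be a
self-diffeomorphism of the boundary manifold `∂W` which maps each end (boundary circle) to itself
(`(T (ψ w)).2 = (T w).2`) and preserves the boundary orientation `oW.boundary`.  Then `ψ` extends
to a self-diffeomorphism `Φ` of `W` (`Φ w = ψ w` on `∂W`).  Proof: the two end maps of `ψ` are
orientation-preserving diffeomorphisms of `𝕊¹` (`isOrientationPreserving_endMap`), hence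
diffeotopic to the identity (Cerf, Prop. 4 at `n = 1`), and the double slide along the two
diffeotopies extends `ψ` (`exists_diffeomorph_extends_of_isDiffeotopicToId`).  Hirsch,
*Differential Topology* (1976), Ch. 8 §2 (proof of Thm. 2.3) with Ch. 9 §3; Cerf (1968),
Appendice, Prop. 4. [cite: HirschDT1976, Ch. 8 §2, proof of Thm. 2.3] -/
theorem exists_diffeomorph_extends_of_isOrientationPreserving
    (T : W ≃ₘ⟮𝓡∂ (1 + 1), (𝓡 1).prod (𝓡∂ 1)⟯ ((𝕊 1) × Set.Icc (0 : ℝ) 1))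
    (oW : SmoothOrientation (𝓡∂ (1 + 1)) W)
    (ψ : (𝓡∂ (1 + 1)).boundary W ≃ₘ⟮𝓡 1, 𝓡 1⟯ (𝓡∂ (1 + 1)).boundary W)
    (hE : ∀ w, (T (ψ w).1).2 = (T w.1).2)
    (hP : IsOrientationPreserving oW.boundary oW.boundary ψ) :
    ∃ Φ : W ≃ₘ⟮𝓡∂ (1 + 1), 𝓡∂ (1 + 1)⟯ W, ∀ w : (𝓡∂ (1 + 1)).boundary W, Φ w.1 = (ψ w).1 := by
  obtain ⟨u⟩ := isOrientable_sphere_holds 1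
  haveI : ConnectedSpace (𝕊 1) := by
    refine isConnected_iff_connectedSpace.mp (isConnected_sphere ?_ 0 zero_le_one)
    rw [← Module.finrank_eq_rank, finrank_euclideanSpace_fin]
    norm_num
  refine exists_diffeomorph_extends_of_isDiffeotopicToId T ψ hE ?_ ?_
  · exact Diffeomorph.isDiffeotopicToId_of_isOrientationPreserving_circle u _
      (isOrientationPreserving_endMap T (Or.inl rfl) ψ hE oW u hP)
  · exact Diffeomorph.isDiffeotopicToId_of_isOrientationPreserving_circle u _
      (isOrientationPreserving_endMap T (Or.inr rfl) ψ hE oW u hP)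

end Circle

end Literature.Topology.FourManifolds
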